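/-
Copyright (c) 2026 the pub-hodgecm-mathlib formalisation cell (harness21).  Prover seat hodgecm-mathlib-K2E4-p11 (g6), Track B ∕ K2-LIT, h413 = `stmt-HodgeConjecture-24833`,
line `K2_E1_TraceFormulaBeta`, campaign «5Res ENDGAME BY FAMILIES», ROADCARD §3′ (M2 v2), the K-TYPE ⇒ LEVEL reduction (dealer K2E1-plan (g7) deal (233)), FILE 1: the units of a
Banach algebra — in particular `GL(V)` for a finite-dimensional (or any Banach) complex space `V` — have NO SMALL SUBGROUPS.  Mathlib only.
-/
import Mathlib.Analysis.SpecialFunctions.Exponential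
import Mathlib.Analysis.Calculus.InverseFunctionTheorem.FDeriv
import HarnessLib

/-!
# K-TYPE ⇒ LEVEL, FILE 1 — `K2E1NoSmallSubgroupsGL`: a Banach algebra's unit group has NO SMALL SUBGROUPS — `∃ ε > 0`, every subgroup of `𝔸ˣ` inside `{‖g − 1‖ < ε}` is trivial (Mathlib only)

Track B ∕ K2-LIT, crux h413 = `stmt-HodgeConjecture-24833`, route of record `HCCMUnconditional`; cell `hodgecm-mathlib`, squad K2, ENGINE E1; dealer K2E1-plan (g7) deal (233) («GL(V) over a
finite-dim complex space has NO SMALL SUBGROUPS: `∃ ε > 0, ∀ H : Subgroup (V →L[ℂ] V)ˣ, (∀ g ∈ H, ‖(g : V →L[ℂ] V) − 1‖ < ε) → H = ⊥` … or any cleaner road you find (exp∕log chart)»).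
THEOREMS ONLY (no `def`, no `instance`, no `notation`, no `sorry`; default heartbeats); lane `--supports stmt-HodgeConjecture-24833 --as helper` (count-neutral).  Pure functional analysis.

THE MATHEMATICS ([MontgomeryZippin1955, §2.10 ∕ Thm p. 56 «Lie groups have no small subgroups»]; [Hall2015, Prop. 2.16 ∕ Cor. 3.44]; where it is used: [MoeglinWaldspurger1995, I.2.17] ∕
ROADCARD §3′ FILE 2 — a finite-dimensional continuous representation of a profinite group is trivial on an open subgroup).  THE EXP CHART ROAD (no eigenvalues, no finite dimension):
in a Banach algebra `𝔸` over `𝕂 = ℝ` or `ℂ` the exponential has strict derivative `1` at `0` (Mathlib `hasStrictFDerivAt_exp_zero`), so by the inverse function theorem it is INJECTIVE on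
a ball `B(0, r)` (`eventually_left_inverse`) and `exp(B(0, r∕2))` is a neighbourhood of `1` (`map_nhds_eq_of_equiv`), containing a ball `B(1, ε)`.  Let `H ≤ 𝔸ˣ` with `‖g − 1‖ < ε` on
`H`, and `g = exp X ∈ H`, `‖X‖ < r∕2`, `X ≠ 0`.  Take the LEAST `n` with `‖nX‖ ≥ r∕2`; then `‖nX‖ < ‖(n−1)X‖ + ‖X‖ < r`.  But `gⁿ = exp(nX) ∈ H ⊆ exp(B(0, r∕2))`, say `= exp Y`,
`‖Y‖ < r∕2`; injectivity on `B(0, r)` gives `nX = Y`, contradicting `‖nX‖ ≥ r∕2`.  Hence `X = 0`, `g = 1`: **`H = ⊥`**.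
* §1 `exp_nsmul_rclike`, `exists_ball_injOn_exp` (exp is injective on a ball at `0` whose half-ball image is a neighbourhood of `1`).
* §2 HEAD **`exists_forall_subgroup_units_eq_bot`** (any Banach `𝕂`-algebra), the hom form **`exists_forall_monoidHom_eq_one`** (a hom `ρ : G →* 𝔸ˣ` which is `ε`-close to `1` on a subgroup
  `U` is trivial on `U` — the shape FILE 2 uses for a profinite `K_f`), and the deal's print **`exists_forall_subgroup_units_End_eq_bot`** for `𝔸 = V →L[ℂ] V`.
HONEST LABEL: HC_CM is proved only modulo the 7 printed citations (2 remaining named inputs: hLiu418 = `stmt-HodgeConjecture-24832`, h413 = `stmt-HodgeConjecture-24833`) until rung 0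
closes; this file asserts no named fact, closes no socket; count-neutral; letter-free, Mathlib-only.

## References
* [MontgomeryZippin1955] D. Montgomery, L. Zippin, *Topological Transformation Groups* (1955), §2.10.
* [Hall2015] B. C. Hall, *Lie Groups, Lie Algebras, and Representations* (2nd ed., 2015), Prop. 2.16, Cor. 3.44.
* [MoeglinWaldspurger1995] C. Mœglin, J.-L. Waldspurger, *Spectral decomposition and Eisenstein series* (1995), I.2.17.
-/

set_option autoImplicit false
set_option linter.dupNamespace false  -- the mandated namespace repeats the summit's segment (`HodgeConjecture.HodgeConjecture`)

noncomputable section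

open Set Filter Topology Metric NormedSpace

namespace Summit.HodgeConjecture.HodgeConjecture.Cruxes.H413.K2E1NoSmallSubgroupsGL

section Banach

/-- `exp (n • x) = (exp x)ⁿ` in a Banach algebra over `𝕂 = ℝ` or `ℂ` (Mathlib's `exp_nsmul` is stated for `ℚ`-normed algebras; here via `exp_add_of_commute_of_mem_ball`, the
exponential series having infinite radius). [folklore] -/
theorem exp_nsmul_rclike (𝕂 : Type*) [RCLike 𝕂] {𝔸 : Type*} [NormedRing 𝔸] [NormedAlgebra 𝕂 𝔸] [CompleteSpace 𝔸] (n : ℕ) (x : 𝔸) :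
    exp (n • x) = exp x ^ n := by
  have hball : ∀ y : 𝔸, y ∈ Metric.eball (0 : 𝔸) (expSeries 𝕂 𝔸).radius := fun y => by
    rw [expSeries_radius_eq_top, Metric.mem_eball]
    exact edist_lt_top y 0
  induction n with
  | zero => rw [zero_smul, pow_zero, exp_zero]
  | succ n ih => rw [succ_nsmul, exp_add_of_commute_of_mem_ball ((Commute.refl x).smul_left n) (hball _) (hball _), ih, pow_succ]

/-- **THE EXP CHART AT THE IDENTITY**: there is `r > 0` such that `exp` is injective on the ball `B(0, r)` of the Banach `𝕂`-algebra `𝔸` and `exp(B(0, r∕2))` is a neighbourhood of `1`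
(inverse function theorem at `0`, Mathlib `hasStrictFDerivAt_exp_zero`). [cite: Hall2015, Prop. 2.16] -/
theorem exists_ball_injOn_exp (𝕂 : Type*) [RCLike 𝕂] {𝔸 : Type*} [NormedRing 𝔸] [NormedAlgebra 𝕂 𝔸] [CompleteSpace 𝔸] :
    ∃ r : ℝ, 0 < r ∧ Set.InjOn (exp : 𝔸 → 𝔸) (ball (0 : 𝔸) r) ∧ exp '' ball (0 : 𝔸) (r / 2) ∈ 𝓝 (1 : 𝔸) := by
  have h : HasStrictFDerivAt (exp : 𝔸 → 𝔸) ((ContinuousLinearEquiv.refl 𝕂 𝔸 : 𝔸 ≃L[𝕂] 𝔸) : 𝔸 →L[𝕂] 𝔸) 0 :=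
    (hasStrictFDerivAt_exp_zero (𝕂 := 𝕂) (𝔸 := 𝔸)).congr_fderiv (by ext x; simp)
  obtain ⟨r, hr, hball⟩ := Metric.eventually_nhds_iff_ball.1 h.eventually_left_inverse
  refine ⟨r, hr, fun x hx y hy hxy => ?_, ?_⟩
  · rw [← hball x hx, ← hball y hy, hxy]
  · have hmap := h.map_nhds_eq_of_equiv
    rw [exp_zero] at hmap
    rw [← hmap]
    exact image_mem_map (ball_mem_nhds (0 : 𝔸) (half_pos hr))

/-- **NO SMALL SUBGROUPS (Banach algebra units).**  There is `ε > 0` such that every subgroup `H` of the unit group `𝔸ˣ` of a Banach `𝕂`-algebra (`𝕂 = ℝ` or `ℂ`) with `‖g − 1‖ < ε` for all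
`g ∈ H` is TRIVIAL.  (Exp chart: write `g = exp X`, `‖X‖ < r∕2`; if `X ≠ 0` the least `n` with `‖nX‖ ≥ r∕2` has `‖nX‖ < r` and `gⁿ = exp(nX) = exp Y` with `‖Y‖ < r∕2`, so `nX = Y` by
injectivity — contradiction.) [cite: MontgomeryZippin1955, §2.10] [cite: Hall2015, Prop. 2.16, Cor. 3.44] -/
theorem exists_forall_subgroup_units_eq_bot (𝕂 : Type*) [RCLike 𝕂] {𝔸 : Type*} [NormedRing 𝔸] [NormedAlgebra 𝕂 𝔸] [CompleteSpace 𝔸] :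
    ∃ ε : ℝ, 0 < ε ∧ ∀ H : Subgroup 𝔸ˣ, (∀ g ∈ H, ‖(g : 𝔸) - 1‖ < ε) → H = ⊥ := by
  classical
  obtain ⟨r, hr, hinj, hnhds⟩ := exists_ball_injOn_exp 𝕂 (𝔸 := 𝔸)
  obtain ⟨ε, hε, hεsub⟩ := Metric.mem_nhds_iff.1 hnhds
  refine ⟨ε, hε, fun H hH => (Subgroup.eq_bot_iff_forall H).2 fun g hg => ?_⟩
  by_contra hne
  -- `g = exp X`, `‖X‖ < r / 2`, `X ≠ 0`
  obtain ⟨X, hX, hgX⟩ := hεsub (mem_ball_iff_norm.2 (hH g hg))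
  rw [mem_ball_zero_iff] at hX
  have hX0 : X ≠ 0 := by
    intro h0
    apply hne
    ext
    rw [← hgX, h0, exp_zero, Units.val_one]
  have hXpos : 0 < ‖X‖ := norm_pos_iff.2 hX0
  -- `n • X = (n : 𝕂) • X` has norm `n‖X‖`
  have hnorm : ∀ n : ℕ, ‖n • X‖ = (n : ℝ) * ‖X‖ := fun n => by
    rw [← Nat.cast_smul_eq_nsmul 𝕂, norm_smul, RCLike.norm_natCast]
  -- the least `n` with `r / 2 ≤ ‖n • X‖`
  have hex : ∃ n : ℕ, r / 2 ≤ ‖n • X‖ := by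
    obtain ⟨n, hn⟩ := exists_nat_ge (r / 2 / ‖X‖)
    exact ⟨n, by rw [hnorm, ← div_le_iff₀ hXpos]; exact hn⟩
  have hn₀spec : r / 2 ≤ ‖Nat.find hex • X‖ := Nat.find_spec hex
  have hn₀pos : Nat.find hex ≠ 0 := by
    intro h0
    rw [h0, zero_smul, norm_zero] at hn₀spec
    linarith
  obtain ⟨k, hk⟩ := Nat.exists_eq_succ_of_ne_zero hn₀pos
  have hklt : ‖k • X‖ < r / 2 := not_le.1 (Nat.find_min hex (show k < Nat.find hex by omega))
  have hn₀lt : ‖Nat.find hex • X‖ < r := by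
    rw [hk, succ_nsmul]
    calc ‖k • X + X‖ ≤ ‖k • X‖ + ‖X‖ := norm_add_le _ _
      _ < r / 2 + r / 2 := add_lt_add hklt hX
      _ = r := by ring
  -- `g ^ n₀ ∈ H` is `exp Y` with `‖Y‖ < r / 2`
  obtain ⟨Y, hY, hgY⟩ := hεsub (mem_ball_iff_norm.2 (hH _ (H.pow_mem hg (Nat.find hex))))
  have hexp : exp Y = exp (Nat.find hex • X) := by
    rw [hgY, Units.val_pow_eq_pow_val, ← hgX, exp_nsmul_rclike 𝕂]
  have hYX : Y = Nat.find hex • X := hinj (ball_subset_ball (by linarith) hY) (mem_ball_zero_iff.2 hn₀lt) hexp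
  rw [mem_ball_zero_iff, hYX] at hY
  exact absurd hn₀spec (not_le.2 hY)

/-- **HOM FORM** (the shape used for a profinite group): there is `ε > 0` such that every group homomorphism `ρ : G →* 𝔸ˣ` which is `ε`-close to `1` on a subgroup `U ≤ G` is TRIVIAL on
`U` (apply the previous theorem to `U.map ρ`). [cite: MontgomeryZippin1955, §2.10] [cite: Hall2015, Cor. 3.44] -/
theorem exists_forall_monoidHom_eq_one (𝕂 : Type*) [RCLike 𝕂] {𝔸 : Type*} [NormedRing 𝔸] [NormedAlgebra 𝕂 𝔸] [CompleteSpace 𝔸] (G : Type*) [Group G] :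
    ∃ ε : ℝ, 0 < ε ∧ ∀ (ρ : G →* 𝔸ˣ) (U : Subgroup G), (∀ u ∈ U, ‖(ρ u : 𝔸) - 1‖ < ε) → ∀ u ∈ U, ρ u = 1 := by
  obtain ⟨ε, hε, hH⟩ := exists_forall_subgroup_units_eq_bot 𝕂 (𝔸 := 𝔸)
  refine ⟨ε, hε, fun ρ U hU u hu => ?_⟩
  have hbot := hH (U.map ρ) (by rintro g ⟨v, hv, rfl⟩; exact hU v hv)
  exact (Subgroup.eq_bot_iff_forall _).1 hbot (ρ u) ⟨u, hu, rfl⟩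

end Banach

/-! ## The deal's print: `GL(V) = (V →L[ℂ] V)ˣ` for a complex Banach (e.g. finite-dimensional) space `V` -/

/-- **`GL(V)` HAS NO SMALL SUBGROUPS** (deal (233) bytes): for a complex Banach space `V` — in particular any finite-dimensional complex normed space —
`∃ ε > 0, ∀ H : Subgroup (V →L[ℂ] V)ˣ, (∀ g ∈ H, ‖(g : V →L[ℂ] V) − 1‖ < ε) → H = ⊥`. [cite: MontgomeryZippin1955, §2.10] [cite: Hall2015, Prop. 2.16, Cor. 3.44] -/
theorem exists_forall_subgroup_units_End_eq_bot (V : Type*) [NormedAddCommGroup V] [NormedSpace ℂ V] [CompleteSpace V] [Nontrivial V] :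
    ∃ ε : ℝ, 0 < ε ∧ ∀ H : Subgroup (V →L[ℂ] V)ˣ, (∀ g ∈ H, ‖(g : V →L[ℂ] V) - 1‖ < ε) → H = ⊥ :=
  exists_forall_subgroup_units_eq_bot ℂ (𝔸 := V →L[ℂ] V)

end Summit.HodgeConjecture.HodgeConjecture.Cruxes.H413.K2E1NoSmallSubgroupsGL

end
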